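import Summits.ResolutionOfSingularities.ResolutionOfSingularities.Theorems.UniversalCellsCampaignW82DiagonalCriterionScheme
import Literature.AlgebraicGeometry.Resolution.SmoothLocusBaseChange
import HarnessLib

/-!
# [OURS · L1 W8.2] THE DIAGONAL CRITERION, POINTWISE: `y` is a smooth point of `Y → Spec K` iff the local ring of
# `Y ×_K Y` at the diagonal point `Δ(y)` is regular — the non-smooth locus is `Δ⁻¹(Sing (Y ×_K Y))`

Cell `res-hironaka` (run/shared/lean/pub/res-hironaka/), LADDER-RESOLUTION rung L (RESCUE), slot W8.2; host route
`UniversalCells`, host item `PrimeFieldToPerfect` (stmt-ResolutionOfSingularities-15233), door 1. Proofs file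
(Theses-free), written by res-L1-s82-pv-1 (gen 6). Pointwise form of (E5) of Cruxes/PrimeFieldToPerfect/KERNEL.md §2
over ANY field `K`, for `q : Y ⟶ Spec K` locally of finite presentation and `y ∈ Y`:

* `diagonal_comp_pullback_map` — naturality of the diagonal along `i : Y' → Y` over `Spec K`.
* `isRegularLocalRing_stalk_diagonal_of_mem_smoothLocus` — `y ∈ sm(q)` ⇒ `𝒪_{Y ×_K Y, Δ(y)}` regular (`q` is smooth on
  an open `V ∋ y`; `V ×_K V ↪ Y ×_K Y` is an open immersion through which `Δ(y)` factors; Stacks 056S).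
* `mem_smoothLocus_of_isRegularLocalRing_stalk_diagonal` — `𝒪_{Y ×_K Y, Δ(y)}` regular ⇒ `y ∈ sm(q)`: on an affine
  chart `Spec A ∋ y` the diagonal point is the prime `μ⁻¹(𝔭)` of `A ⊗_K A` (Mathlib `diagonal_SpecMap`), so the affine
  criterion `isSmoothAt_of_isRegularLocalRing_localization_diagonal` gives `A` smooth at `𝔭`, i.e. `A_f` smooth over
  `K` for some `f ∉ 𝔭`, and `Spec A_f ↪ Y` is an open immersion through `y`.
* **`mem_smoothLocus_iff_isRegularLocalRing_stalk_diagonal`**; `smoothLocus_eq_preimage_diagonal_regular`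
  (`sm(q) = Δ⁻¹ {w | 𝒪_{Y×Y,w} regular}`).
* (append) `isRegular_pullback_self_iff_forall_diagonal` — `Y ×_K Y` is regular iff it is regular ALONG THE DIAGONAL;
  `smooth_iff_forall_closedPoints_isRegularLocalRing_stalk_diagonal` — closed points `y` suffice (`Y` is Jacobson).

READING for slot W8.2: the defect of a regular model `Y` of a twist `X₀^{(p^e)}` over `M(t)` — its non-smooth locus
(gen 5: `pr₁(Sing Y^{(p)})`, `…RegularTwistLocus`) — is also `Δ⁻¹(Sing(Y ×_{M(t)} Y))`, with no hypothesis on the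
ground field.

HONEST FRAMING. OURS theorems (classical, assembled from the tree and Mathlib); NOT statements of [Hironaka2017];
nothing attributed to its author. A normal form, not progress on the open residual. AI work, weaker than expert review;
no claim beyond the kernel. No `sorry`, no new axioms.

## References (locators only)
* A. Grothendieck, *EGA IV₄*, Publ. Math. IHÉS 32 (1967), 17.12.3–17.12.5.
* The Stacks Project, Tags 056S, 00TV. [StacksProject]
-/

noncomputable section

set_option linter.dupNamespace false -- mandated namespace of this single-conjunct summit

open CategoryTheory CategoryTheory.Limits AlgebraicGeometry TopologicalSpace TensorProduct
open Literature.AlgebraicGeometry.Resolution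

namespace Summit.ResolutionOfSingularities.ResolutionOfSingularities.Theorems.CampaignW82

universe u

/-! ## Naturality of the diagonal -/

/-- **Naturality of the diagonal**: for `i : Y' ⟶ Y` and `f' = i ≫ f`, the diagonal of `f'` followed by
`i ×_S i : Y' ×_S Y' ⟶ Y ×_S Y` is `i` followed by the diagonal of `f`. [folklore] -/
theorem diagonal_comp_pullback_map {Y Y' S : Scheme.{u}} (f : Y ⟶ S) (f' : Y' ⟶ S) (i : Y' ⟶ Y)
    (e : f' = i ≫ f) :
    pullback.diagonal f' ≫ pullback.map f' f' f f i i (𝟙 S) ((Category.comp_id _).trans e)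
      ((Category.comp_id _).trans e) = i ≫ pullback.diagonal f := by
  ext1
  · simp only [Category.assoc, pullback.lift_fst, pullback.diagonal_fst_assoc, pullback.diagonal_fst,
      Category.comp_id]
  · simp only [Category.assoc, pullback.lift_snd, pullback.diagonal_snd_assoc, pullback.diagonal_snd,
      Category.comp_id]

variable {K : Type u} [Field K] {Y : Scheme.{u}} (q : Y ⟶ Spec (.of K))

/-! ## Smooth point ⇒ the self-product is regular at the diagonal point -/

/-- **`y ∈ sm(Y/K)` ⇒ `𝒪_{Y ×_K Y, Δ(y)}` is a regular local ring**: `q` is smooth on an open `V ∋ y`, `V ×_K V`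
is regular (smooth over `K`) and `V ×_K V ↪ Y ×_K Y` is an open immersion through which `Δ(y)` factors.
[cite: StacksProject, Tag 056S] -/
theorem isRegularLocalRing_stalk_diagonal_of_mem_smoothLocus [LocallyOfFinitePresentation q] {y : Y}
    (hy : y ∈ q.smoothLocus) :
    IsRegularLocalRing ((pullback q q).presheaf.stalk ((pullback.diagonal q).base y)) := by
  obtain ⟨V, hyV, hsm⟩ := exists_smooth_ι_comp_of_mem_smoothLocus q hy
  haveI := hsm
  -- `V ×_K V` is regular and `j : V ×_K V → Y ×_K Y` is an open immersion
  have hreg : Scheme.IsRegular (pullback (V.ι ≫ q) (V.ι ≫ q)) := isRegular_pullback_self_of_smooth (V.ι ≫ q)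
  let j := pullback.map (V.ι ≫ q) (V.ι ≫ q) q q V.ι V.ι (𝟙 _)
    ((Category.comp_id _).trans rfl) ((Category.comp_id _).trans rfl)
  haveI hj : IsOpenImmersion j :=
    MorphismProperty.pullbackMap (P := @IsOpenImmersion) (inferInstance : IsOpenImmersion V.ι)
      (inferInstance : IsOpenImmersion V.ι) rfl rfl
  -- `Δ(y) = j (Δ_V y)`
  have hpt : (pullback.diagonal q).base y =
      j.base ((pullback.diagonal (V.ι ≫ q)).base ⟨y, hyV⟩) := by
    have h := diagonal_comp_pullback_map q (V.ι ≫ q) V.ι rfl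
    have h' := congrArg (fun φ => φ.base ⟨y, hyV⟩) h
    exact h'.symm
  rw [hpt]
  haveI := hreg ((pullback.diagonal (V.ι ≫ q)).base ⟨y, hyV⟩)
  exact IsRegularLocalRing.of_ringEquiv
    (asIso (j.stalkMap ((pullback.diagonal (V.ι ≫ q)).base ⟨y, hyV⟩))).commRingCatIsoToRingEquiv.symm

/-! ## The self-product regular at the diagonal point ⇒ smooth point -/

/-- **`𝒪_{Y ×_K Y, Δ(y)}` regular ⇒ `y ∈ sm(Y/K)`** (`q` locally of finite presentation): on an affine chart
`Spec A ∋ y` (`A = Γ(Y, U)`, `y ↔ 𝔭`) the diagonal point is the prime `μ⁻¹(𝔭)` of `A ⊗_K A` (Mathlib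
`diagonal_SpecMap`) and `Spec (A ⊗_K A) ↪ Y ×_K Y` is an open immersion, so `(A ⊗_K A)_{μ⁻¹ 𝔭}` is regular; the
affine criterion makes `A` smooth at `𝔭`, hence `A_f` smooth over `K` for some `f ∉ 𝔭`, and `Spec A_f ↪ Y` is an
open immersion through `y` on which `q` is smooth. [folklore] -/
theorem mem_smoothLocus_of_isRegularLocalRing_stalk_diagonal [LocallyOfFinitePresentation q] {y : Y}
    (h : IsRegularLocalRing ((pullback q q).presheaf.stalk ((pullback.diagonal q).base y))) :
    y ∈ q.smoothLocus := by
  classical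
  -- an affine chart at `y`
  obtain ⟨U, hU, hyU, -⟩ :=
    exists_isAffineOpen_mem_and_subset (X := Y) (x := y) (U := ⊤) (Opens.mem_top y)
  let φ : CommRingCat.of K ⟶ Γ(Y, U) := Spec.preimage (hU.fromSpec ≫ q)
  have hSpec : Spec.map φ = hU.fromSpec ≫ q := Spec.map_preimage _
  have hft : φ.hom.FiniteType := by
    have : LocallyOfFiniteType (Spec.map φ) := by rw [hSpec]; infer_instance
    exact (HasRingHomProperty.Spec_iff (P := @LocallyOfFiniteType)).mp this
  algebraize [φ.hom]
  haveI : Algebra.FinitePresentation K Γ(Y, U) :=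
    (Algebra.FinitePresentation.of_finiteType (R := K) (A := Γ(Y, U))).mp inferInstance
  have hφ : Spec.map (CommRingCat.ofHom (algebraMap K Γ(Y, U))) = hU.fromSpec ≫ q := by
    rw [← hSpec]
    rfl
  -- the prime of `y` and the diagonal prime over it
  let 𝔭 : Ideal Γ(Y, U) := (hU.primeIdealOf ⟨y, hyU⟩).asIdeal
  have hy𝔭 : hU.fromSpec.base (hU.primeIdealOf ⟨y, hyU⟩) = y := hU.fromSpec_primeIdealOf ⟨y, hyU⟩
  let 𝔓 : Ideal (Γ(Y, U) ⊗[K] Γ(Y, U)) := Ideal.comap (Algebra.TensorProduct.lmul' K (S := Γ(Y, U))) 𝔭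
  haveI : 𝔓.IsPrime := Ideal.IsPrime.comap _
  let z₀ : Spec (.of (Γ(Y, U) ⊗[K] Γ(Y, U))) := ⟨𝔓, inferInstance⟩
  -- the open immersion `j' : Spec (A ⊗_K A) ≅ Spec A ×_K Spec A ↪ Y ×_K Y`
  let j := pullback.map (Spec.map (CommRingCat.ofHom (algebraMap K Γ(Y, U))))
    (Spec.map (CommRingCat.ofHom (algebraMap K Γ(Y, U)))) q q hU.fromSpec hU.fromSpec (𝟙 _)
    ((Category.comp_id _).trans hφ) ((Category.comp_id _).trans hφ)
  haveI hj : IsOpenImmersion j :=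
    MorphismProperty.pullbackMap (P := @IsOpenImmersion) (inferInstance : IsOpenImmersion hU.fromSpec)
      (inferInstance : IsOpenImmersion hU.fromSpec) hφ hφ
  let j' := (pullbackSpecIso K Γ(Y, U) Γ(Y, U)).inv ≫ j
  -- `Δ(y) = j' z₀`
  have hpt : (pullback.diagonal q).base y = j'.base z₀ := by
    have hnat := diagonal_comp_pullback_map q (Spec.map (CommRingCat.ofHom (algebraMap K Γ(Y, U))))
      hU.fromSpec hφ
    rw [diagonal_SpecMap] at hnat
    have h' := congrArg (fun ψ => ψ.base (hU.primeIdealOf ⟨y, hyU⟩)) hnat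
    rw [← hy𝔭]
    exact h'.symm
  -- hence `(A ⊗_K A)_𝔓` is regular
  rw [hpt] at h
  haveI : IsRegularLocalRing ((Spec (.of (Γ(Y, U) ⊗[K] Γ(Y, U)))).presheaf.stalk z₀) :=
    @IsRegularLocalRing.of_ringEquiv _ _ h _ _ (asIso (j'.stalkMap z₀)).commRingCatIsoToRingEquiv
  letI : Algebra (Γ(Y, U) ⊗[K] Γ(Y, U)) ((Spec (.of (Γ(Y, U) ⊗[K] Γ(Y, U)))).presheaf.stalk z₀) :=
    inferInstanceAs (Algebra (Γ(Y, U) ⊗[K] Γ(Y, U))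
      ((Spec.structureSheaf (CommRingCat.of (Γ(Y, U) ⊗[K] Γ(Y, U)))).presheaf.stalk z₀))
  haveI : IsLocalization.AtPrime ((Spec (.of (Γ(Y, U) ⊗[K] Γ(Y, U)))).presheaf.stalk z₀) 𝔓 :=
    StructureSheaf.IsLocalization.to_stalk (CommRingCat.of (Γ(Y, U) ⊗[K] Γ(Y, U))) z₀
  haveI : IsRegularLocalRing (Localization.AtPrime 𝔓) :=
    IsRegularLocalRing.of_ringEquiv (IsLocalization.algEquiv 𝔓.primeCompl
      ((Spec (.of (Γ(Y, U) ⊗[K] Γ(Y, U)))).presheaf.stalk z₀) (Localization.AtPrime 𝔓)).toRingEquiv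
  -- the affine criterion: `A` is `K`-smooth at `𝔭`, so `A_f` is smooth for some `f ∉ 𝔭`
  haveI hsm : Algebra.IsSmoothAt K 𝔭 :=
    isSmoothAt_of_isRegularLocalRing_localization_diagonal K Γ(Y, U) 𝔭 𝔓 rfl
  obtain ⟨f, hf𝔭, hsmf⟩ := Algebra.IsSmoothAt.exists_notMem_smooth K 𝔭
  -- the open immersion `i : Spec A_f ↪ Y` through `y`, on which `q` is smooth
  let i : Spec (.of (Localization.Away f)) ⟶ Y :=
    Spec.map (CommRingCat.ofHom (algebraMap Γ(Y, U) (Localization.Away f))) ≫ hU.fromSpec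
  haveI : IsOpenImmersion (Spec.map (CommRingCat.ofHom (algebraMap Γ(Y, U) (Localization.Away f)))) :=
    IsOpenImmersion.of_isLocalization f
  haveI : IsOpenImmersion i := inferInstance
  have hiq : i ≫ q = Spec.map (CommRingCat.ofHom (algebraMap K (Localization.Away f))) := by
    change (Spec.map _ ≫ hU.fromSpec) ≫ q = _
    rw [Category.assoc, ← hφ, ← Spec.map_comp, ← CommRingCat.ofHom_comp, ← IsScalarTower.algebraMap_eq]
  haveI : Smooth (i ≫ q) := by
    rw [hiq, HasRingHomProperty.Spec_iff (P := @Smooth)]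
    exact RingHom.smooth_algebraMap.mpr hsmf
  -- `y` lies in the image of `i`
  have hrange : (hU.primeIdealOf ⟨y, hyU⟩ : PrimeSpectrum Γ(Y, U)) ∈
      Set.range (PrimeSpectrum.comap (algebraMap Γ(Y, U) (Localization.Away f))) := by
    rw [PrimeSpectrum.localization_away_comap_range (Localization.Away f) f]
    exact hf𝔭
  obtain ⟨z, hz⟩ := hrange
  have hiz : i.base z = y := by
    change hU.fromSpec.base ((Spec.map (CommRingCat.ofHom (algebraMap Γ(Y, U) (Localization.Away f)))).base z) = y
    have : (Spec.map (CommRingCat.ofHom (algebraMap Γ(Y, U) (Localization.Away f)))).base z =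
        hU.primeIdealOf ⟨y, hyU⟩ := hz
    rw [this, hy𝔭]
  have hz' : z ∈ i ⁻¹ᵁ q.smoothLocus := by
    rw [Scheme.Hom.preimage_smoothLocus_eq, Scheme.Hom.smoothLocus_eq_top]
    trivial
  rw [← hiz]
  exact hz'

/-- **THE DIAGONAL CRITERION, POINTWISE** (`q : Y ⟶ Spec K` locally of finite presentation, ANY field `K`,
`y ∈ Y`): `y` is a smooth point of `q` iff the local ring of `Y ×_K Y` at `Δ(y)` is regular. [folklore] -/
theorem mem_smoothLocus_iff_isRegularLocalRing_stalk_diagonal [LocallyOfFinitePresentation q] (y : Y) :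
    y ∈ q.smoothLocus ↔ IsRegularLocalRing ((pullback q q).presheaf.stalk ((pullback.diagonal q).base y)) :=
  ⟨isRegularLocalRing_stalk_diagonal_of_mem_smoothLocus q, mem_smoothLocus_of_isRegularLocalRing_stalk_diagonal q⟩

/-- **The smooth locus is the preimage under the diagonal of the regular locus of the self-product**:
`sm(Y/K) = Δ⁻¹ {w ∈ Y ×_K Y | 𝒪_{Y ×_K Y, w} regular}`; equivalently the non-smooth locus is
`Δ⁻¹(Sing(Y ×_K Y))`. [folklore] -/
theorem smoothLocus_eq_preimage_diagonal_regular [LocallyOfFinitePresentation q] :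
    (q.smoothLocus : Set Y) =
      (pullback.diagonal q).base ⁻¹' {w | IsRegularLocalRing ((pullback q q).presheaf.stalk w)} := by
  ext y
  exact mem_smoothLocus_iff_isRegularLocalRing_stalk_diagonal q y

/-! ## Corollaries (gen 6 append): regular along the diagonal is regular everywhere; closed points suffice -/

/-- **A self-product is regular iff it is regular along the diagonal** (`q : Y ⟶ Spec K` locally of finite
presentation, any field `K`): if `𝒪_{Y ×_K Y, Δ(y)}` is regular for every `y`, then `q` is smooth (pointwise
criterion), so `Y ×_K Y` is smooth over `K` and regular at ALL of its points. [folklore] -/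
theorem isRegular_pullback_self_iff_forall_diagonal [LocallyOfFinitePresentation q] :
    Scheme.IsRegular (pullback q q) ↔
      ∀ y : Y, IsRegularLocalRing ((pullback q q).presheaf.stalk ((pullback.diagonal q).base y)) := by
  refine ⟨fun h y => h _, fun h => ?_⟩
  haveI : Smooth q := by
    rw [← Scheme.Hom.smoothLocus_eq_top_iff]
    exact top_le_iff.mp fun y _ => mem_smoothLocus_of_isRegularLocalRing_stalk_diagonal q (h y)
  exact isRegular_pullback_self_of_smooth q

/-- **Smoothness over a field is detected by the self-product at the CLOSED points** (`q` locally of finite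
presentation; `Y` is a Jacobson space): `q` is smooth iff `𝒪_{Y ×_K Y, Δ(y)}` is regular for every CLOSED point
`y` — the non-smooth locus is closed, so if non-empty it contains a closed point. [folklore] -/
theorem smooth_iff_forall_closedPoints_isRegularLocalRing_stalk_diagonal [LocallyOfFinitePresentation q] :
    Smooth q ↔ ∀ y ∈ closedPoints Y,
      IsRegularLocalRing ((pullback q q).presheaf.stalk ((pullback.diagonal q).base y)) := by
  refine ⟨fun _ y _ => isRegularLocalRing_stalk_diagonal_of_mem_smoothLocus q
    (by rw [Scheme.Hom.smoothLocus_eq_top]; trivial), fun h => ?_⟩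
  haveI : JacobsonSpace Y := LocallyOfFiniteType.jacobsonSpace q
  rw [← Scheme.Hom.smoothLocus_eq_top_iff]
  by_contra hne
  have hZ : ((q.smoothLocus : Set Y)ᶜ).Nonempty := by
    rw [Set.nonempty_compl]
    intro htop
    exact hne (TopologicalSpace.Opens.ext (by rw [htop]; rfl))
  obtain ⟨y, hyZ, hyc⟩ :=
    nonempty_inter_closedPoints hZ (q.smoothLocus.isOpen.isClosed_compl.isLocallyClosed)
  exact hyZ (mem_smoothLocus_of_isRegularLocalRing_stalk_diagonal q (h y hyc))

end Summit.ResolutionOfSingularities.ResolutionOfSingularities.Theorems.CampaignW82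

end
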